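import Literature.AlgebraicGeometry.Motives.MumfordTateGroupDirectSum
import HarnessLib

/-!
# Milne's centraliser `C(A) = End_{End⁰(A)}(V(A))` of a direct sum: `C(H₁ ⊕ H₂) ⊆ C(H₁) × C(H₂)` (block diagonal), with
# equality iff `Hom(H₁, H₂) = 0 = Hom(H₂, H₁)`, and `C(H ⊕ H) = C(H)` diagonally — on the abstract `ℚ`-Hodge structure
# (Milne 1999 §1 p. 643: "Let `A = A₁ × ⋯ × A_s`. Then `C(A) ⊂ C(A₁) × ⋯ × C(A_s)`, with equality holding if and only if
# `Hom(Aᵢ, Aⱼ) = 0`"; "the diagonal action of `C(A)` on `rV(A)` identifies `C(A)` with `C(A^r)`"; Proposition 1.1)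

[topic AlgebraicGeometry/Motives]

Layer `Literature/AlgebraicGeometry/Motives`, lane `lit-hodgefound` (Track 2 foundations library; seat `lit-hodgefound-p34`,
generation 18, self-proposed row g18-#3 of `run/shared/lean/pub/lit-hodgefound/SKELETON.md`). THEOREMS ONLY (no definition,
no named fact; net debt `0`). Third file of the seat's programme «Milne 1999 §1 on the abstract polarized `ℚ`-Hodge structure»
(g18-#1 `Motives/HodgeStructureLefschetzGroupPoints`: `C(H)`, `†`, `S(H)`, `G(H)` on points; g18-#2
`Motives/HodgeStructureCentralizerEquivariantForms`: Prop. 1.3); this file is INDEPENDENT of both (it imports only the tree's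
direct-sum file `Motives/MumfordTateGroupDirectSum`, the seat's g9-#1).

CARRIER. `H₁ : HodgeStructure V₁ n`, `H₂ : HodgeStructure V₂ n` pure `ℚ`-Hodge structures of the same weight on
finite-dimensional spaces, their direct sum `H₁.prod H₂` on `V₁ × V₂` (`Motives/HodgeStructure`, Deligne Hodge II 2.1) with its
morphisms `inl`, `inr`, `fst`, `snd` (`Hom.prodInl`, `Hom.prodInr`, `Hom.prodFst`, `Hom.prodSnd`); `E_φ(H) = H.endAlg`; MILNE'S
`C(H) := Z_{End_ℚ(V)}(E_φ(H))` = Mathlib's `Subalgebra.centralizer ℚ (H.endAlg : Set (Module.End ℚ V))` (the spelling of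
g17-#1 / g17-#3 / g18-#1); "`(c₁, c₂) ∈ C(A₁) × C(A₂)` acting on `V(A₁) ⊕ V(A₂)`" = Mathlib's block-diagonal map
`LinearMap.prodMap c₁ c₂`, and on `GL`: `LinearEquiv.prodCongr g₁ g₂`. The torus-level twin (lattice matrices, real points,
finite products `X₁ × ⋯ × X_s`) is p22's `Literature/Geometry/Kaehler/ComplexTorusLefschetzGroupFiniteProduct` (Q705:
`endCentralizerAlg_pi_le`, `endCentralizerAlg_pi_eq_iff`) and the `H¹(A(ℂ); ℂ)` twin is
`Literature/AlgebraicGeometry/Milne1999/LefschetzCentraliserProducts` — OTHER carriers, BY NAME, nothing imported or restated.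

## The source, verbatim

J. S. Milne, *Lefschetz classes on abelian varieties*, Duke Math. J. **96** (1999) 639–675 [Milne1999LefschetzClasses]
(held `paper:doi-10-1215-s0012-7094-99-09620-5`, author's folios; Duke page ≈ folio + 638), §1 p0005 L12–L27 (p. 643):
"For any positive integer `r`, `V(A^r) = rV(A)`, and **the diagonal action of `C(A)` on `rV(A)` identifies `C(A)` with
`C(A^r)`** (as `k`-algebras with involution). Let `A = A₁ × ⋯ × A_s`. Then **`C(A) ⊂ C(A₁) × ⋯ × C(A_s)`, with equality
holding if and only if `Hom(Aᵢ, Aⱼ) = 0` for all `i, j`, `i ≠ j`.** […] On combining the remarks in the last three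
paragraphs, we obtain the following statement: **Proposition 1.1.** Let `A₁, …, A_s` be a set of representatives for the
simple isogeny factors of `A`, so that there exists an isogeny `A₁^{r₁} × ⋯ × A_s^{r_s} → A` for some `rᵢ > 0`. Any such
isogeny induces an isomorphism `C(A₁) × ⋯ × C(A_s) → C(A)` of `k`-algebras with involution, which is independent of the
choice of the isogeny." The mechanism (B. Moonen, *An introduction to Mumford–Tate groups* (2004) [Moonen2004MT] §4 Lemma 4.6,
as in the tree's `Motives/MumfordTateGroupDirectSum`): an operator commuting with the Hodge idempotents `inl ∘ fst`,
`inr ∘ snd ∈ End_HS(H₁ ⊕ H₂)` is block diagonal, and `End_HS(H₁ ⊕ H₂)` decomposes into the four blocks `End_HS(H₁)`,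
`Hom_HS(H₂, H₁)`, `Hom_HS(H₁, H₂)`, `End_HS(H₂)` (Deligne, Hodge II 2.1: `HS` is an additive — indeed abelian — category).

## What is PROVED (binary direct sums, `k = ℚ`; `r = 2` for the powers)

* §0 the four blocks: `inl ∘ a ∘ fst`, `inr ∘ b ∘ snd`, `inr ∘ f ∘ fst`, `inl ∘ g ∘ snd ∈ E_φ(H₁ ⊕ H₂)` for `a ∈ E_φ(H₁)`,
  `b ∈ E_φ(H₂)`, `f ∈ Hom(H₁, H₂)`, `g ∈ Hom(H₂, H₁)`; conversely the blocks `fst ∘ a ∘ inl ∈ E_φ(H₁)`, `snd ∘ a ∘ inr ∈ E_φ(H₂)`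
  of `a ∈ E_φ(H₁ ⊕ H₂)` and its off-diagonal blocks are morphisms.
* §1 **"`C(A) ⊂ C(A₁) × ⋯ × C(A_s)`"**: every `c ∈ C(H₁ ⊕ H₂)` is BLOCK DIAGONAL (`fst_apply_inr_eq_zero_of_mem_centralizer_endAlg_prod`,
  `snd_apply_inl_eq_zero_…`, `eq_prodMap_of_mem_centralizer_endAlg_prod`) with blocks `c₁ = fst ∘ c ∘ inl ∈ C(H₁)`,
  `c₂ = snd ∘ c ∘ inr ∈ C(H₂)` (`fst_comp_comp_inl_mem_centralizer_endAlg`, `snd_comp_comp_inr_mem_…`) that INTERTWINE all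
  morphisms between the summands (`c₂ ∘ f = f ∘ c₁`, `c₁ ∘ g = g ∘ c₂`); packaged: **`exists_prodMap_eq_of_mem_centralizer_endAlg_prod`**
  and the exact description **`prodMap_mem_centralizer_endAlg_prod_iff`**:
  `(c₁, c₂) ∈ C(H₁ ⊕ H₂) ⟺ c₁ ∈ C(H₁) ∧ c₂ ∈ C(H₂) ∧ c₂ f = f c₁ (∀ f) ∧ c₁ g = g c₂ (∀ g)`.
* §2 **"with equality holding if and only if `Hom(Aᵢ, Aⱼ) = 0` for all `i ≠ j`"**:
  **`forall_prodMap_mem_centralizer_endAlg_prod_iff`** — `C(H₁) × C(H₂) ⊆ C(H₁ ⊕ H₂)` (hence `=`) iff `Hom(H₁, H₂) = 0` and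
  `Hom(H₂, H₁) = 0` (for "⟹" test the block scalars `(1, 0)`); and the equality statement
  `mem_centralizer_endAlg_prod_iff_of_hom_eq_zero`.
* §3 **"the diagonal action of `C(A)` on `rV(A)` identifies `C(A)` with `C(A^r)`"** (`r = 2`):
  **`mem_centralizer_endAlg_prod_self_iff`** — `c ∈ C(H ⊕ H) ⟺ c = (c₀, c₀)` diagonal with `c₀ ∈ C(H)` (intertwining with
  `id ∈ Hom(H, H)` forces `c₁ = c₂`), and `prodMap_mem_centralizer_endAlg_prod_self_iff`.

NOT here: `s > 2` summands and `r > 2` (iterate; the `pi`-carrier version is routine and omitted); the involution clause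
"as `k`-algebras with involution" for the product polarization and the GROUP `S(A₁) × ⋯ × S(A_s) → S(A)` (Prop. 1.5) — the
next row of this seat (needs g18-#1's `Polarization.lefschetzGroup`); isogenies (for abstract Hodge structures an "isogeny"
is an isomorphism `V ≃ V'`, transport is routine); `K`-points `C(H) ⊗ K`.

## References

* [Milne1999LefschetzClasses] J. S. Milne, *Lefschetz classes on abelian varieties*, Duke Math. J. 96 (1999) 639–675, §1
  p. 643 (the paragraphs "For any positive integer r" and "Let A = A₁ × ⋯ × A_s") and Proposition 1.1.
* [Moonen2004MT] B. Moonen, *An introduction to Mumford–Tate groups* (2004), §4 Lemma 4.6 (block-diagonality on `V₁ ⊕ V₂`).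
* [DeligneHodgeII1971] P. Deligne, *Théorie de Hodge II*, Publ. Math. IHÉS 40 (1971), 2.1 (direct sums and morphisms of
  Hodge structures).
-/

noncomputable section

namespace Literature.AlgebraicGeometry.Motives

namespace HodgeStructure

universe u

variable {V₁ : Type u} [AddCommGroup V₁] [Module ℚ V₁] {V₂ : Type u} [AddCommGroup V₂] [Module ℚ V₂] {n : ℤ}
  (H₁ : HodgeStructure V₁ n) (H₂ : HodgeStructure V₂ n)

/-! ## §0 The four blocks of `End_HS(H₁ ⊕ H₂)` -/

section Blocks

/-- `inl ∘ a ∘ fst ∈ E_φ(H₁ ⊕ H₂)` for `a ∈ E_φ(H₁)` (a composite of morphisms). [cite: DeligneHodgeII1971, 2.1] -/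
theorem inl_comp_comp_fst_mem_endAlg_prod {a : Module.End ℚ V₁} (ha : a ∈ H₁.endAlg) :
    LinearMap.inl ℚ V₁ V₂ ∘ₗ a ∘ₗ LinearMap.fst ℚ V₁ V₂ ∈ (H₁.prod H₂).endAlg :=
  Hom.toLinearMap_mem_endAlg ((Hom.prodInl H₁ H₂).comp ((endAlg.toHom ⟨a, ha⟩).comp (Hom.prodFst H₁ H₂)))

/-- `inr ∘ b ∘ snd ∈ E_φ(H₁ ⊕ H₂)` for `b ∈ E_φ(H₂)`. [cite: DeligneHodgeII1971, 2.1] -/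
theorem inr_comp_comp_snd_mem_endAlg_prod {b : Module.End ℚ V₂} (hb : b ∈ H₂.endAlg) :
    LinearMap.inr ℚ V₁ V₂ ∘ₗ b ∘ₗ LinearMap.snd ℚ V₁ V₂ ∈ (H₁.prod H₂).endAlg :=
  Hom.toLinearMap_mem_endAlg ((Hom.prodInr H₁ H₂).comp ((endAlg.toHom ⟨b, hb⟩).comp (Hom.prodSnd H₁ H₂)))

/-- `inr ∘ f ∘ fst ∈ E_φ(H₁ ⊕ H₂)` for a morphism `f : H₁ → H₂`. [cite: DeligneHodgeII1971, 2.1] -/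
theorem inr_comp_hom_comp_fst_mem_endAlg_prod (f : Hom H₁ H₂) :
    LinearMap.inr ℚ V₁ V₂ ∘ₗ f.toLinearMap ∘ₗ LinearMap.fst ℚ V₁ V₂ ∈ (H₁.prod H₂).endAlg :=
  Hom.toLinearMap_mem_endAlg ((Hom.prodInr H₁ H₂).comp (f.comp (Hom.prodFst H₁ H₂)))

/-- `inl ∘ g ∘ snd ∈ E_φ(H₁ ⊕ H₂)` for a morphism `g : H₂ → H₁`. [cite: DeligneHodgeII1971, 2.1] -/
theorem inl_comp_hom_comp_snd_mem_endAlg_prod (g : Hom H₂ H₁) :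
    LinearMap.inl ℚ V₁ V₂ ∘ₗ g.toLinearMap ∘ₗ LinearMap.snd ℚ V₁ V₂ ∈ (H₁.prod H₂).endAlg :=
  Hom.toLinearMap_mem_endAlg ((Hom.prodInl H₁ H₂).comp (g.comp (Hom.prodSnd H₁ H₂)))

/-- The `(1,1)`-block of `a ∈ E_φ(H₁ ⊕ H₂)` lies in `E_φ(H₁)`: `fst ∘ a ∘ inl ∈ E_φ(H₁)`. [cite: DeligneHodgeII1971, 2.1] -/
theorem fst_comp_comp_inl_mem_endAlg {a : Module.End ℚ (V₁ × V₂)} (ha : a ∈ (H₁.prod H₂).endAlg) :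
    LinearMap.fst ℚ V₁ V₂ ∘ₗ a ∘ₗ LinearMap.inl ℚ V₁ V₂ ∈ H₁.endAlg :=
  Hom.toLinearMap_mem_endAlg ((Hom.prodFst H₁ H₂).comp ((endAlg.toHom ⟨a, ha⟩).comp (Hom.prodInl H₁ H₂)))

/-- The `(2,2)`-block of `a ∈ E_φ(H₁ ⊕ H₂)` lies in `E_φ(H₂)`: `snd ∘ a ∘ inr ∈ E_φ(H₂)`. [cite: DeligneHodgeII1971, 2.1] -/
theorem snd_comp_comp_inr_mem_endAlg {a : Module.End ℚ (V₁ × V₂)} (ha : a ∈ (H₁.prod H₂).endAlg) :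
    LinearMap.snd ℚ V₁ V₂ ∘ₗ a ∘ₗ LinearMap.inr ℚ V₁ V₂ ∈ H₂.endAlg :=
  Hom.toLinearMap_mem_endAlg ((Hom.prodSnd H₁ H₂).comp ((endAlg.toHom ⟨a, ha⟩).comp (Hom.prodInr H₁ H₂)))

/-- The `(2,1)`-block of `a ∈ E_φ(H₁ ⊕ H₂)` is a morphism `H₁ → H₂`. [cite: DeligneHodgeII1971, 2.1] -/
theorem exists_hom_toLinearMap_eq_snd_comp_comp_inl {a : Module.End ℚ (V₁ × V₂)} (ha : a ∈ (H₁.prod H₂).endAlg) :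
    ∃ f : Hom H₁ H₂, f.toLinearMap = LinearMap.snd ℚ V₁ V₂ ∘ₗ a ∘ₗ LinearMap.inl ℚ V₁ V₂ :=
  ⟨(Hom.prodSnd H₁ H₂).comp ((endAlg.toHom ⟨a, ha⟩).comp (Hom.prodInl H₁ H₂)), rfl⟩

/-- The `(1,2)`-block of `a ∈ E_φ(H₁ ⊕ H₂)` is a morphism `H₂ → H₁`. [cite: DeligneHodgeII1971, 2.1] -/
theorem exists_hom_toLinearMap_eq_fst_comp_comp_inr {a : Module.End ℚ (V₁ × V₂)} (ha : a ∈ (H₁.prod H₂).endAlg) :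
    ∃ g : Hom H₂ H₁, g.toLinearMap = LinearMap.fst ℚ V₁ V₂ ∘ₗ a ∘ₗ LinearMap.inr ℚ V₁ V₂ :=
  ⟨(Hom.prodFst H₁ H₂).comp ((endAlg.toHom ⟨a, ha⟩).comp (Hom.prodInr H₁ H₂)), rfl⟩

omit H₁ H₂ in
/-- Block decomposition of an endomorphism of `V₁ × V₂` applied to a vector:
`a (v, w) = (a₁₁ v + a₁₂ w, a₂₁ v + a₂₂ w)`. Private plumbing. [folklore] -/
private theorem prod_apply_eq_blocks (a : Module.End ℚ (V₁ × V₂)) (x : V₁ × V₂) :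
    a x = ((LinearMap.fst ℚ V₁ V₂ ∘ₗ a ∘ₗ LinearMap.inl ℚ V₁ V₂) x.1 + (LinearMap.fst ℚ V₁ V₂ ∘ₗ a ∘ₗ LinearMap.inr ℚ V₁ V₂) x.2,
      (LinearMap.snd ℚ V₁ V₂ ∘ₗ a ∘ₗ LinearMap.inl ℚ V₁ V₂) x.1 + (LinearMap.snd ℚ V₁ V₂ ∘ₗ a ∘ₗ LinearMap.inr ℚ V₁ V₂) x.2) := by
  have hx : x = LinearMap.inl ℚ V₁ V₂ x.1 + LinearMap.inr ℚ V₁ V₂ x.2 := by simp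
  conv_lhs => rw [hx, map_add]
  ext <;> simp

end Blocks

/-! ## §1 `C(H₁ ⊕ H₂) ⊆ C(H₁) × C(H₂)`: block-diagonality, the blocks, the intertwining relations -/

section Centralizer

variable {H₁ H₂}

/-- An element of `C(H₁ ⊕ H₂)` commutes with the Hodge idempotent `inl ∘ fst` (pointwise form). [cite: Moonen2004MT, §4 Lemma 4.6] -/
theorem inl_fst_apply_eq_of_mem_centralizer_endAlg_prod {c : Module.End ℚ (V₁ × V₂)}
    (hc : c ∈ Subalgebra.centralizer ℚ ((H₁.prod H₂).endAlg : Set (Module.End ℚ (V₁ × V₂)))) (x : V₁ × V₂) :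
    (LinearMap.inl ℚ V₁ V₂ (c x).1 : V₁ × V₂) = c (LinearMap.inl ℚ V₁ V₂ x.1) := by
  have h := (Subalgebra.mem_centralizer_iff ℚ).1 hc _ (inl_comp_comp_fst_mem_endAlg_prod H₁ H₂ H₁.endAlg.one_mem)
  have hx := LinearMap.congr_fun h x
  simpa [Module.End.mul_apply] using hx

/-- An element of `C(H₁ ⊕ H₂)` commutes with the Hodge idempotent `inr ∘ snd` (pointwise form). [cite: Moonen2004MT, §4 Lemma 4.6] -/
theorem inr_snd_apply_eq_of_mem_centralizer_endAlg_prod {c : Module.End ℚ (V₁ × V₂)}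
    (hc : c ∈ Subalgebra.centralizer ℚ ((H₁.prod H₂).endAlg : Set (Module.End ℚ (V₁ × V₂)))) (x : V₁ × V₂) :
    (LinearMap.inr ℚ V₁ V₂ (c x).2 : V₁ × V₂) = c (LinearMap.inr ℚ V₁ V₂ x.2) := by
  have h := (Subalgebra.mem_centralizer_iff ℚ).1 hc _ (inr_comp_comp_snd_mem_endAlg_prod H₁ H₂ H₂.endAlg.one_mem)
  have hx := LinearMap.congr_fun h x
  simpa [Module.End.mul_apply] using hx

/-- **Block-diagonality, I**: the `(1,2)`-block of `c ∈ C(H₁ ⊕ H₂)` vanishes, `fst (c (0, w)) = 0`.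
[cite: Milne1999LefschetzClasses, §1 p. 643 ("C(A) ⊂ C(A₁) × ⋯ × C(A_s)")] [cite: Moonen2004MT, §4 Lemma 4.6] -/
theorem fst_apply_inr_eq_zero_of_mem_centralizer_endAlg_prod {c : Module.End ℚ (V₁ × V₂)}
    (hc : c ∈ Subalgebra.centralizer ℚ ((H₁.prod H₂).endAlg : Set (Module.End ℚ (V₁ × V₂)))) (w : V₂) :
    (c (LinearMap.inr ℚ V₁ V₂ w)).1 = 0 := by
  have h := inr_snd_apply_eq_of_mem_centralizer_endAlg_prod hc (LinearMap.inr ℚ V₁ V₂ w)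
  simp only [LinearMap.inr_apply] at h
  have h1 := congrArg Prod.fst h
  simpa using h1.symm

/-- **Block-diagonality, II**: the `(2,1)`-block of `c ∈ C(H₁ ⊕ H₂)` vanishes, `snd (c (v, 0)) = 0`.
[cite: Milne1999LefschetzClasses, §1 p. 643] [cite: Moonen2004MT, §4 Lemma 4.6] -/
theorem snd_apply_inl_eq_zero_of_mem_centralizer_endAlg_prod {c : Module.End ℚ (V₁ × V₂)}
    (hc : c ∈ Subalgebra.centralizer ℚ ((H₁.prod H₂).endAlg : Set (Module.End ℚ (V₁ × V₂)))) (v : V₁) :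
    (c (LinearMap.inl ℚ V₁ V₂ v)).2 = 0 := by
  have h := inl_fst_apply_eq_of_mem_centralizer_endAlg_prod hc (LinearMap.inl ℚ V₁ V₂ v)
  simp only [LinearMap.inl_apply] at h
  have h1 := congrArg Prod.snd h
  simpa using h1.symm

/-- **`C(A) ⊂ C(A₁) × C(A₂)`, block form**: `c ∈ C(H₁ ⊕ H₂)` is the block-diagonal map `(c₁, c₂)` with
`c₁ = fst ∘ c ∘ inl`, `c₂ = snd ∘ c ∘ inr`. [cite: Milne1999LefschetzClasses, §1 p. 643] [cite: Moonen2004MT, §4 Lemma 4.6] -/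
theorem eq_prodMap_of_mem_centralizer_endAlg_prod {c : Module.End ℚ (V₁ × V₂)}
    (hc : c ∈ Subalgebra.centralizer ℚ ((H₁.prod H₂).endAlg : Set (Module.End ℚ (V₁ × V₂)))) :
    c = LinearMap.prodMap (LinearMap.fst ℚ V₁ V₂ ∘ₗ c ∘ₗ LinearMap.inl ℚ V₁ V₂)
      (LinearMap.snd ℚ V₁ V₂ ∘ₗ c ∘ₗ LinearMap.inr ℚ V₁ V₂) := by
  refine LinearMap.ext fun x ↦ ?_
  rw [prod_apply_eq_blocks c x, LinearMap.prodMap_apply]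
  have h12 := fst_apply_inr_eq_zero_of_mem_centralizer_endAlg_prod hc x.2
  have h21 := snd_apply_inl_eq_zero_of_mem_centralizer_endAlg_prod hc x.1
  simp only [LinearMap.coe_comp, Function.comp_apply, LinearMap.fst_apply, LinearMap.snd_apply] at h12 h21 ⊢
  rw [h12, h21, add_zero, zero_add]

/-- **The first block of `c ∈ C(H₁ ⊕ H₂)` lies in `C(H₁)`** (`c` commutes with `inl ∘ a ∘ fst` for `a ∈ E_φ(H₁)`).
[cite: Milne1999LefschetzClasses, §1 p. 643] -/
theorem fst_comp_comp_inl_mem_centralizer_endAlg {c : Module.End ℚ (V₁ × V₂)}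
    (hc : c ∈ Subalgebra.centralizer ℚ ((H₁.prod H₂).endAlg : Set (Module.End ℚ (V₁ × V₂)))) :
    LinearMap.fst ℚ V₁ V₂ ∘ₗ c ∘ₗ LinearMap.inl ℚ V₁ V₂ ∈ Subalgebra.centralizer ℚ (H₁.endAlg : Set (Module.End ℚ V₁)) := by
  rw [Subalgebra.mem_centralizer_iff]
  intro a ha
  have h := (Subalgebra.mem_centralizer_iff ℚ).1 hc _ (inl_comp_comp_fst_mem_endAlg_prod H₁ H₂ ha)
  refine LinearMap.ext fun v ↦ ?_
  have hv := congrArg Prod.fst (LinearMap.congr_fun h (LinearMap.inl ℚ V₁ V₂ v))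
  simpa [Module.End.mul_apply] using hv

/-- **The second block of `c ∈ C(H₁ ⊕ H₂)` lies in `C(H₂)`.** [cite: Milne1999LefschetzClasses, §1 p. 643] -/
theorem snd_comp_comp_inr_mem_centralizer_endAlg {c : Module.End ℚ (V₁ × V₂)}
    (hc : c ∈ Subalgebra.centralizer ℚ ((H₁.prod H₂).endAlg : Set (Module.End ℚ (V₁ × V₂)))) :
    LinearMap.snd ℚ V₁ V₂ ∘ₗ c ∘ₗ LinearMap.inr ℚ V₁ V₂ ∈ Subalgebra.centralizer ℚ (H₂.endAlg : Set (Module.End ℚ V₂)) := by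
  rw [Subalgebra.mem_centralizer_iff]
  intro b hb
  have h := (Subalgebra.mem_centralizer_iff ℚ).1 hc _ (inr_comp_comp_snd_mem_endAlg_prod H₁ H₂ hb)
  refine LinearMap.ext fun w ↦ ?_
  have hw := congrArg Prod.snd (LinearMap.congr_fun h (LinearMap.inr ℚ V₁ V₂ w))
  simpa [Module.End.mul_apply] using hw

/-- **The blocks of `c ∈ C(H₁ ⊕ H₂)` intertwine every morphism `f : H₁ → H₂`**: `c₂ ∘ f = f ∘ c₁` (`c` commutes with
`inr ∘ f ∘ fst ∈ E_φ(H₁ ⊕ H₂)`) — the obstruction to "equality" when `Hom(A₁, A₂) ≠ 0`. [cite: Milne1999LefschetzClasses, §1 p. 643] -/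
theorem snd_comp_comp_inr_comp_hom_eq_of_mem_centralizer_endAlg_prod {c : Module.End ℚ (V₁ × V₂)}
    (hc : c ∈ Subalgebra.centralizer ℚ ((H₁.prod H₂).endAlg : Set (Module.End ℚ (V₁ × V₂)))) (f : Hom H₁ H₂) :
    (LinearMap.snd ℚ V₁ V₂ ∘ₗ c ∘ₗ LinearMap.inr ℚ V₁ V₂) ∘ₗ f.toLinearMap =
      f.toLinearMap ∘ₗ (LinearMap.fst ℚ V₁ V₂ ∘ₗ c ∘ₗ LinearMap.inl ℚ V₁ V₂) := by
  have h := (Subalgebra.mem_centralizer_iff ℚ).1 hc _ (inr_comp_hom_comp_fst_mem_endAlg_prod H₁ H₂ f)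
  refine LinearMap.ext fun v ↦ ?_
  have hv := congrArg Prod.snd (LinearMap.congr_fun h (LinearMap.inl ℚ V₁ V₂ v))
  have h12 := fst_apply_inr_eq_zero_of_mem_centralizer_endAlg_prod hc (f.toLinearMap v)
  have h21 := snd_apply_inl_eq_zero_of_mem_centralizer_endAlg_prod hc v
  -- `c (inr (f v)) = inr (c₂ (f v))` and `c (inl v) = inl (c₁ v)` by block-diagonality
  have hcr : c (LinearMap.inr ℚ V₁ V₂ (f.toLinearMap v)) =
      LinearMap.inr ℚ V₁ V₂ (c (LinearMap.inr ℚ V₁ V₂ (f.toLinearMap v))).2 := by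
    ext
    · simpa using h12
    · simp
  simp only [Module.End.mul_apply, LinearMap.coe_comp, Function.comp_apply, LinearMap.fst_apply, LinearMap.snd_apply,
    LinearMap.inl_apply, LinearMap.inr_apply] at hv ⊢
  rw [hv]

/-- **The blocks of `c ∈ C(H₁ ⊕ H₂)` intertwine every morphism `g : H₂ → H₁`**: `c₁ ∘ g = g ∘ c₂`.
[cite: Milne1999LefschetzClasses, §1 p. 643] -/
theorem fst_comp_comp_inl_comp_hom_eq_of_mem_centralizer_endAlg_prod {c : Module.End ℚ (V₁ × V₂)}
    (hc : c ∈ Subalgebra.centralizer ℚ ((H₁.prod H₂).endAlg : Set (Module.End ℚ (V₁ × V₂)))) (g : Hom H₂ H₁) :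
    (LinearMap.fst ℚ V₁ V₂ ∘ₗ c ∘ₗ LinearMap.inl ℚ V₁ V₂) ∘ₗ g.toLinearMap =
      g.toLinearMap ∘ₗ (LinearMap.snd ℚ V₁ V₂ ∘ₗ c ∘ₗ LinearMap.inr ℚ V₁ V₂) := by
  have h := (Subalgebra.mem_centralizer_iff ℚ).1 hc _ (inl_comp_hom_comp_snd_mem_endAlg_prod H₁ H₂ g)
  refine LinearMap.ext fun w ↦ ?_
  have hw := congrArg Prod.fst (LinearMap.congr_fun h (LinearMap.inr ℚ V₁ V₂ w))
  simp only [Module.End.mul_apply, LinearMap.coe_comp, Function.comp_apply, LinearMap.fst_apply, LinearMap.snd_apply,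
    LinearMap.inl_apply, LinearMap.inr_apply] at hw ⊢
  rw [hw]

/-- **The exact description of `C(H₁ ⊕ H₂)` inside `C(H₁) × C(H₂)`**: a block-diagonal `(c₁, c₂)` lies in `C(H₁ ⊕ H₂)`
iff `c₁ ∈ C(H₁)`, `c₂ ∈ C(H₂)` and the pair intertwines all morphisms between the summands (`c₂ f = f c₁` for
`f : H₁ → H₂`, `c₁ g = g c₂` for `g : H₂ → H₁`) — `End_HS(H₁ ⊕ H₂)` consists of the four blocks `End_HS(H₁)`, `Hom(H₂, H₁)`,
`Hom(H₁, H₂)`, `End_HS(H₂)`. [cite: Milne1999LefschetzClasses, §1 p. 643 ("with equality holding if and only if Hom(Aᵢ, Aⱼ) = 0")]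
[cite: DeligneHodgeII1971, 2.1] -/
theorem prodMap_mem_centralizer_endAlg_prod_iff (c₁ : Module.End ℚ V₁) (c₂ : Module.End ℚ V₂) :
    LinearMap.prodMap c₁ c₂ ∈ Subalgebra.centralizer ℚ ((H₁.prod H₂).endAlg : Set (Module.End ℚ (V₁ × V₂))) ↔
      c₁ ∈ Subalgebra.centralizer ℚ (H₁.endAlg : Set (Module.End ℚ V₁)) ∧
        c₂ ∈ Subalgebra.centralizer ℚ (H₂.endAlg : Set (Module.End ℚ V₂)) ∧
          (∀ f : Hom H₁ H₂, c₂ ∘ₗ f.toLinearMap = f.toLinearMap ∘ₗ c₁) ∧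
            ∀ g : Hom H₂ H₁, c₁ ∘ₗ g.toLinearMap = g.toLinearMap ∘ₗ c₂ := by
  have e₁ : LinearMap.fst ℚ V₁ V₂ ∘ₗ LinearMap.prodMap c₁ c₂ ∘ₗ LinearMap.inl ℚ V₁ V₂ = c₁ := by ext; simp
  have e₂ : LinearMap.snd ℚ V₁ V₂ ∘ₗ LinearMap.prodMap c₁ c₂ ∘ₗ LinearMap.inr ℚ V₁ V₂ = c₂ := by ext; simp
  constructor
  · intro hc
    refine ⟨e₁ ▸ fst_comp_comp_inl_mem_centralizer_endAlg hc, e₂ ▸ snd_comp_comp_inr_mem_centralizer_endAlg hc,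
      fun f ↦ ?_, fun g ↦ ?_⟩
    · have h := snd_comp_comp_inr_comp_hom_eq_of_mem_centralizer_endAlg_prod hc f
      rwa [e₁, e₂] at h
    · have h := fst_comp_comp_inl_comp_hom_eq_of_mem_centralizer_endAlg_prod hc g
      rwa [e₁, e₂] at h
  · rintro ⟨h₁, h₂, hf, hg⟩
    rw [Subalgebra.mem_centralizer_iff]
    intro a ha
    -- the four blocks of `a`
    have ha₁₁ := fst_comp_comp_inl_mem_endAlg H₁ H₂ ha
    have ha₂₂ := snd_comp_comp_inr_mem_endAlg H₁ H₂ ha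
    obtain ⟨f, hf'⟩ := exists_hom_toLinearMap_eq_snd_comp_comp_inl H₁ H₂ ha
    obtain ⟨g, hg'⟩ := exists_hom_toLinearMap_eq_fst_comp_comp_inr H₁ H₂ ha
    have c₁₁ := (Subalgebra.mem_centralizer_iff ℚ).1 h₁ _ ha₁₁
    have c₂₂ := (Subalgebra.mem_centralizer_iff ℚ).1 h₂ _ ha₂₂
    have c₂₁ := hf f
    have c₁₂ := hg g
    rw [hf'] at c₂₁
    rw [hg'] at c₁₂
    refine LinearMap.ext fun x ↦ ?_
    rw [Module.End.mul_apply, Module.End.mul_apply, prod_apply_eq_blocks a (LinearMap.prodMap c₁ c₂ x),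
      prod_apply_eq_blocks a x, LinearMap.prodMap_apply, LinearMap.prodMap_apply, map_add, map_add]
    have t₁₁ := LinearMap.congr_fun c₁₁ x.1
    have t₂₂ := LinearMap.congr_fun c₂₂ x.2
    have t₂₁ := LinearMap.congr_fun c₂₁ x.1
    have t₁₂ := LinearMap.congr_fun c₁₂ x.2
    simp only [Module.End.mul_apply, LinearMap.coe_comp, Function.comp_apply] at t₁₁ t₂₂ t₂₁ t₁₂ ⊢
    rw [t₁₁, t₂₂, t₂₁, t₁₂]

/-- **"`C(A) ⊂ C(A₁) × ⋯ × C(A_s)`"** (`s = 2`): every `c ∈ C(H₁ ⊕ H₂)` is `(c₁, c₂)` with `cᵢ ∈ C(Hᵢ)`.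
[cite: Milne1999LefschetzClasses, §1 p. 643] -/
theorem exists_prodMap_eq_of_mem_centralizer_endAlg_prod {c : Module.End ℚ (V₁ × V₂)}
    (hc : c ∈ Subalgebra.centralizer ℚ ((H₁.prod H₂).endAlg : Set (Module.End ℚ (V₁ × V₂)))) :
    ∃ c₁ ∈ Subalgebra.centralizer ℚ (H₁.endAlg : Set (Module.End ℚ V₁)),
      ∃ c₂ ∈ Subalgebra.centralizer ℚ (H₂.endAlg : Set (Module.End ℚ V₂)), c = LinearMap.prodMap c₁ c₂ :=
  ⟨_, fst_comp_comp_inl_mem_centralizer_endAlg hc, _, snd_comp_comp_inr_mem_centralizer_endAlg hc,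
    eq_prodMap_of_mem_centralizer_endAlg_prod hc⟩

/-- Membership in `C(H₁ ⊕ H₂)`, fully described: `c ∈ C(H₁ ⊕ H₂)` iff `c = (c₁, c₂)` is block diagonal with `cᵢ ∈ C(Hᵢ)`
intertwining all morphisms between the summands. [cite: Milne1999LefschetzClasses, §1 p. 643] -/
theorem mem_centralizer_endAlg_prod_iff (c : Module.End ℚ (V₁ × V₂)) :
    c ∈ Subalgebra.centralizer ℚ ((H₁.prod H₂).endAlg : Set (Module.End ℚ (V₁ × V₂))) ↔
      ∃ c₁ ∈ Subalgebra.centralizer ℚ (H₁.endAlg : Set (Module.End ℚ V₁)),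
        ∃ c₂ ∈ Subalgebra.centralizer ℚ (H₂.endAlg : Set (Module.End ℚ V₂)),
          c = LinearMap.prodMap c₁ c₂ ∧ (∀ f : Hom H₁ H₂, c₂ ∘ₗ f.toLinearMap = f.toLinearMap ∘ₗ c₁) ∧
            ∀ g : Hom H₂ H₁, c₁ ∘ₗ g.toLinearMap = g.toLinearMap ∘ₗ c₂ := by
  constructor
  · intro hc
    have heq := eq_prodMap_of_mem_centralizer_endAlg_prod hc
    rw [heq] at hc
    obtain ⟨h₁, h₂, hf, hg⟩ := (prodMap_mem_centralizer_endAlg_prod_iff _ _).1 hc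
    exact ⟨_, h₁, _, h₂, heq, hf, hg⟩
  · rintro ⟨c₁, h₁, c₂, h₂, rfl, hf, hg⟩
    exact (prodMap_mem_centralizer_endAlg_prod_iff c₁ c₂).2 ⟨h₁, h₂, hf, hg⟩

end Centralizer

/-! ## §2 "with equality holding if and only if `Hom(Aᵢ, Aⱼ) = 0` for all `i ≠ j`" -/

section Equality

variable {H₁ H₂}

/-- **"with equality holding if and only if `Hom(Aᵢ, Aⱼ) = 0` for all `i, j`, `i ≠ j`"**: `C(H₁) × C(H₂) ⊆ C(H₁ ⊕ H₂)`
(hence `C(H₁ ⊕ H₂) = C(H₁) × C(H₂)`, by §1) iff there are no non-zero morphisms `H₁ → H₂` and `H₂ → H₁` (for "⟹" the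
block scalars `(1, 0) ∈ C(H₁) × C(H₂)` commute with `inr ∘ f ∘ fst` only if `f = 0`). [cite: Milne1999LefschetzClasses, §1 p. 643] -/
theorem forall_prodMap_mem_centralizer_endAlg_prod_iff :
    (∀ c₁ ∈ Subalgebra.centralizer ℚ (H₁.endAlg : Set (Module.End ℚ V₁)),
        ∀ c₂ ∈ Subalgebra.centralizer ℚ (H₂.endAlg : Set (Module.End ℚ V₂)),
          LinearMap.prodMap c₁ c₂ ∈ Subalgebra.centralizer ℚ ((H₁.prod H₂).endAlg : Set (Module.End ℚ (V₁ × V₂)))) ↔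
      (∀ f : Hom H₁ H₂, f.toLinearMap = 0) ∧ ∀ g : Hom H₂ H₁, g.toLinearMap = 0 := by
  constructor
  · intro h
    have h10 := (prodMap_mem_centralizer_endAlg_prod_iff (H₁ := H₁) (H₂ := H₂) 1 0).1
      (h 1 (Subalgebra.one_mem _) 0 (Subalgebra.zero_mem _))
    refine ⟨fun f ↦ LinearMap.ext fun v ↦ ?_, fun g ↦ LinearMap.ext fun w ↦ ?_⟩
    · have hf := LinearMap.congr_fun (h10.2.2.1 f) v
      simp only [LinearMap.coe_comp, Function.comp_apply, LinearMap.zero_apply, Module.End.one_apply] at hf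
      rw [LinearMap.zero_apply, ← hf]
    · have hg := LinearMap.congr_fun (h10.2.2.2 g) w
      simp only [LinearMap.coe_comp, Function.comp_apply, LinearMap.zero_apply, Module.End.one_apply, map_zero] at hg
      rw [LinearMap.zero_apply, hg]
  · rintro ⟨hf, hg⟩ c₁ h₁ c₂ h₂
    exact (prodMap_mem_centralizer_endAlg_prod_iff c₁ c₂).2
      ⟨h₁, h₂, fun f ↦ by rw [hf f, LinearMap.comp_zero, LinearMap.zero_comp],
        fun g ↦ by rw [hg g, LinearMap.comp_zero, LinearMap.zero_comp]⟩

/-- **`C(H₁ ⊕ H₂) = C(H₁) × C(H₂)` when `Hom(H₁, H₂) = 0 = Hom(H₂, H₁)`** (e.g. non-isogenous simple summands; the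
`s = 2` case of Proposition 1.1's isomorphism `C(A₁) × ⋯ × C(A_s) → C(A)`): `c ∈ C(H₁ ⊕ H₂)` iff `c = (c₁, c₂)` with
`cᵢ ∈ C(Hᵢ)`. [cite: Milne1999LefschetzClasses, §1 p. 643 and Prop. 1.1] -/
theorem mem_centralizer_endAlg_prod_iff_of_hom_eq_zero (hf : ∀ f : Hom H₁ H₂, f.toLinearMap = 0)
    (hg : ∀ g : Hom H₂ H₁, g.toLinearMap = 0) (c : Module.End ℚ (V₁ × V₂)) :
    c ∈ Subalgebra.centralizer ℚ ((H₁.prod H₂).endAlg : Set (Module.End ℚ (V₁ × V₂))) ↔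
      ∃ c₁ ∈ Subalgebra.centralizer ℚ (H₁.endAlg : Set (Module.End ℚ V₁)),
        ∃ c₂ ∈ Subalgebra.centralizer ℚ (H₂.endAlg : Set (Module.End ℚ V₂)), c = LinearMap.prodMap c₁ c₂ := by
  refine ⟨exists_prodMap_eq_of_mem_centralizer_endAlg_prod, ?_⟩
  rintro ⟨c₁, h₁, c₂, h₂, rfl⟩
  exact forall_prodMap_mem_centralizer_endAlg_prod_iff.2 ⟨hf, hg⟩ c₁ h₁ c₂ h₂

omit H₁ H₂ in
/-- `(c₁, c₂) ↦ c₁ ⊕ c₂` is injective — with `mem_centralizer_endAlg_prod_iff_of_hom_eq_zero` this is the bijectivity of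
Proposition 1.1's map `C(A₁) × C(A₂) → C(A)` ("induces an isomorphism") for `s = 2`, `r₁ = r₂ = 1`.
[cite: Milne1999LefschetzClasses, §1 Prop. 1.1 (p. 643)] -/
theorem prodMap_injective : Function.Injective
    (fun p : Module.End ℚ V₁ × Module.End ℚ V₂ ↦ LinearMap.prodMap p.1 p.2) := by
  rintro ⟨c₁, c₂⟩ ⟨c₁', c₂'⟩ h
  have h1 : c₁ = c₁' := by
    refine LinearMap.ext fun v ↦ ?_
    simpa using congrArg Prod.fst (LinearMap.congr_fun h (v, 0))
  have h2 : c₂ = c₂' := by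
    refine LinearMap.ext fun w ↦ ?_
    simpa using congrArg Prod.snd (LinearMap.congr_fun h (0, w))
  rw [h1, h2]

end Equality

/-! ## §3 Powers: "the diagonal action of `C(A)` on `rV(A)` identifies `C(A)` with `C(A^r)`" (`r = 2`) -/

section Powers

variable {V : Type u} [AddCommGroup V] [Module ℚ V] {H : HodgeStructure V n}

/-- **`(c₁, c₂) ∈ C(H ⊕ H) ⟺ c₁ = c₂ ∈ C(H)`**: intertwining with `id ∈ Hom(H, H)` forces the two blocks to agree.
[cite: Milne1999LefschetzClasses, §1 p. 643 ("the diagonal action of C(A) on rV(A) identifies C(A) with C(A^r)")] -/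
theorem prodMap_mem_centralizer_endAlg_prod_self_iff (c₁ c₂ : Module.End ℚ V) :
    LinearMap.prodMap c₁ c₂ ∈ Subalgebra.centralizer ℚ ((H.prod H).endAlg : Set (Module.End ℚ (V × V))) ↔
      c₁ ∈ Subalgebra.centralizer ℚ (H.endAlg : Set (Module.End ℚ V)) ∧ c₂ = c₁ := by
  rw [prodMap_mem_centralizer_endAlg_prod_iff]
  constructor
  · rintro ⟨h₁, -, hf, -⟩
    have h := hf (Hom.id H)
    change c₂ ∘ₗ LinearMap.id = LinearMap.id ∘ₗ c₁ at h
    rw [LinearMap.comp_id, LinearMap.id_comp] at h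
    exact ⟨h₁, h⟩
  · rintro ⟨h₁, rfl⟩
    exact ⟨h₁, h₁, fun f ↦ ((Subalgebra.mem_centralizer_iff ℚ).1 h₁ _ (Hom.toLinearMap_mem_endAlg f)).symm,
      fun g ↦ ((Subalgebra.mem_centralizer_iff ℚ).1 h₁ _ (Hom.toLinearMap_mem_endAlg g)).symm⟩

/-- **`C(H ⊕ H) = Δ C(H)`**: `c ∈ C(H ⊕ H)` iff `c = (c₀, c₀)` is the diagonal action of some `c₀ ∈ C(H)` ("the diagonal action
of `C(A)` on `rV(A)` identifies `C(A)` with `C(A^r)`", `r = 2`). [cite: Milne1999LefschetzClasses, §1 p. 643] -/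
theorem mem_centralizer_endAlg_prod_self_iff (c : Module.End ℚ (V × V)) :
    c ∈ Subalgebra.centralizer ℚ ((H.prod H).endAlg : Set (Module.End ℚ (V × V))) ↔
      ∃ c₀ ∈ Subalgebra.centralizer ℚ (H.endAlg : Set (Module.End ℚ V)), c = LinearMap.prodMap c₀ c₀ := by
  constructor
  · intro hc
    have heq := eq_prodMap_of_mem_centralizer_endAlg_prod hc
    rw [heq] at hc
    obtain ⟨h₁, h₂⟩ := (prodMap_mem_centralizer_endAlg_prod_self_iff _ _).1 hc
    exact ⟨_, h₁, heq.trans (by rw [h₂])⟩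
  · rintro ⟨c₀, h₀, rfl⟩
    exact (prodMap_mem_centralizer_endAlg_prod_self_iff c₀ c₀).2 ⟨h₀, rfl⟩

end Powers

end HodgeStructure

end Literature.AlgebraicGeometry.Motives
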